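import Summits.Ventures.YMGap.RobustBall.MassGapOnBallS
import HarnessLib

/-!
# Venture YMGap, track ROBUST-BALL (tier 2) — indexed families of terms are members of the weighted ball

HONEST FRAMING. WHAT THIS IS: a venture file (cell `pub-ymgap`, track Y2 ROBUST-BALL, seat rb-p1), the
generic BOOKKEEPING behind infinite-range members of the tier-2 ball `MemBallZdS a Λ t` of
`MassGapOnBallS.lean`. A perturbation is usually given not as a potential `X ↦ W_X` on link sets but as a
family of TERMS `φ_i` (`i` in a countable index set: loops, plaquette pairs, …), each carried by a finite
link set `code i`; the potential collects the terms with a given carrier,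
`W_X = ∑_{i : code i = X} φ_i` (`indexedPotential`, finite fibres `fib X`). We prove
`memBallZdS_indexed`: if every term is continuous, depends on its carrier, is bounded by `M_i`, has
one-link oscillation witnesses `o_i` and Frobenius–Lipschitz witnesses `l_i`, and THROUGH EVERY LINK `e`
the index sums converge with
`∑_{i : e ∈ code i} o_i(e) ≤ a`, `∑_{i : e ∈ code i} ∑_{y ∈ code i, y ≠ e} l_i(y) e^{t‖e - y‖_∞} ≤ Λ`
(plus summability of `M_i` and of the self-moduli `l_i(e)` through `e`), then `W ∈ MemBallZdS a Λ t`.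
The only mathematics is the fibre identity `∑_X ∑_{i ∈ fib X} g_i = ∑_i g_i` for nonnegative summable
`g`, used as the inequality `≤` on partial sums (disjoint fibres). WHAT IT IS NOT: no measure, no
estimate on a Gibbs state, no number; nothing about the continuum limit or the Clay problem.

References: H.-O. Georgii, *Gibbs Measures and Phase Transitions* (2011), (2.3) (summable potentials);
the loads are those of `MassGapOnBallS.lean` (this track).
-/

noncomputable section

open MeasureTheory Filter Function Topology Real
open Literature.Probability.LatticeModels
open Literature.Probability.LatticeModels.DobrushinMetric
open Literature.MathematicalPhysics.QuantumLattice
open Literature.MathematicalPhysics.QuantumFieldTheory hiding ZdEdge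

namespace Summit.Ventures.YMGap.RobustBall

variable {d N : ℕ} {ι : Type*}

/-! ### Fibres of the carrier map and their partial sums -/

section Fibre

variable {code : ι → Finset (ZdEdge d)} {fib : Finset (ZdEdge d) → Finset ι}

/-- Distinct link sets have disjoint fibres. -/
theorem disjoint_fib (hfib : ∀ X i, i ∈ fib X ↔ code i = X) {X X' : Finset (ZdEdge d)} (h : X ≠ X') :
    Disjoint (fib X) (fib X') :=
  Finset.disjoint_left.2 fun i hi hi' => h (((hfib X i).1 hi).symm.trans ((hfib X' i).1 hi'))

/-- A partial sum over link sets of fibre sums is a partial sum over the index. -/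
theorem sum_sum_fib_eq [DecidableEq ι] (hfib : ∀ X i, i ∈ fib X ↔ code i = X)
    (S : Finset (Finset (ZdEdge d))) (g : ι → ℝ) : ∑ X ∈ S, ∑ i ∈ fib X, g i = ∑ i ∈ S.biUnion fib, g i := by
  rw [Finset.sum_biUnion (fun X _ X' _ h => disjoint_fib hfib h)]

/-- **Fibre sums of a nonnegative summable family are summable over link sets.** -/
theorem summable_sum_fib (hfib : ∀ X i, i ∈ fib X ↔ code i = X) {g : ι → ℝ} (hg0 : ∀ i, 0 ≤ g i)
    (hg : Summable g) : Summable fun X => ∑ i ∈ fib X, g i := by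
  classical
  exact summable_of_sum_le (fun X => Finset.sum_nonneg fun i _ => hg0 i) fun S => by
    rw [sum_sum_fib_eq hfib S g]
    exact hg.sum_le_tsum _ (fun i _ => hg0 i)

/-- **The fibre inequality** `∑_X ∑_{i ∈ fib X} g_i ≤ ∑_i g_i` for nonnegative summable `g`. -/
theorem tsum_sum_fib_le (hfib : ∀ X i, i ∈ fib X ↔ code i = X) {g : ι → ℝ} (hg0 : ∀ i, 0 ≤ g i)
    (hg : Summable g) : ∑' X, ∑ i ∈ fib X, g i ≤ ∑' i, g i := by
  classical
  exact Real.tsum_le_of_sum_le (fun X => Finset.sum_nonneg fun i _ => hg0 i) fun S => by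
    rw [sum_sum_fib_eq hfib S g]
    exact hg.sum_le_tsum _ (fun i _ => hg0 i)

/-- On the fibre of `X` an indicator of `e ∈ code i` is the indicator of `e ∈ X`. -/
theorem sum_fib_ite_mem_eq (hfib : ∀ X i, i ∈ fib X ↔ code i = X) (X : Finset (ZdEdge d)) (e : ZdEdge d)
    (g : ι → ℝ) :
    ∑ i ∈ fib X, (if e ∈ code i then g i else 0) = if e ∈ X then ∑ i ∈ fib X, g i else 0 := by
  split_ifs with heX
  · exact Finset.sum_congr rfl fun i hi => by rw [(hfib X i).1 hi, if_pos heX]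
  · exact Finset.sum_eq_zero fun i hi => by rw [(hfib X i).1 hi, if_neg heX]

/-- Same with a two-link indicator. -/
theorem sum_fib_ite_mem_mem_eq (hfib : ∀ X i, i ∈ fib X ↔ code i = X) (X : Finset (ZdEdge d))
    (e y : ZdEdge d) (g : ι → ℝ) :
    ∑ i ∈ fib X, (if e ∈ code i ∧ y ∈ code i then g i else 0) =
      if e ∈ X ∧ y ∈ X then ∑ i ∈ fib X, g i else 0 := by
  split_ifs with h
  · exact Finset.sum_congr rfl fun i hi => by rw [(hfib X i).1 hi, if_pos h]
  · exact Finset.sum_eq_zero fun i hi => by rw [(hfib X i).1 hi, if_neg h]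

end Fibre

/-! ### The indexed potential -/

section Potential

variable (fib : Finset (ZdEdge d) → Finset ι)
  (φ : ι → LGConfig d (Matrix.specialUnitaryGroup (Fin N) ℂ) → ℝ)

/-- **The potential of an indexed family of terms**: `W_X(U) = ∑_{i ∈ fib X} φ_i(U)`, the sum of the
terms carried by the link set `X`. -/
def indexedPotential : Potential (ZdEdge d) (Matrix.specialUnitaryGroup (Fin N) ℂ) := fun X U =>
  ∑ i ∈ fib X, φ i U

/-- Unfolding lemma. -/
@[simp] theorem indexedPotential_apply (X : Finset (ZdEdge d))
    (U : LGConfig d (Matrix.specialUnitaryGroup (Fin N) ℂ)) :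
    indexedPotential fib φ X U = ∑ i ∈ fib X, φ i U := rfl

end Potential

/-! ### Membership in the weighted ball -/

section Member

variable {code : ι → Finset (ZdEdge d)} {fib : Finset (ZdEdge d) → Finset ι}
  {φ : ι → LGConfig d (Matrix.specialUnitaryGroup (Fin N) ℂ) → ℝ}

/-- A finite sum of terms depending on their carriers depends on the common carrier. -/
theorem dependsOn_indexedPotential (hfib : ∀ X i, i ∈ fib X ↔ code i = X)
    (hdep : ∀ i, DependsOn (φ i) (↑(code i) : Set (ZdEdge d))) (X : Finset (ZdEdge d)) :
    DependsOn (indexedPotential fib φ X) (↑X : Set (ZdEdge d)) := by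
  intro U V hUV
  simp only [indexedPotential_apply]
  exact Finset.sum_congr rfl fun i hi => hdep i (fun z hz => hUV z (by rw [← (hfib X i).1 hi]; exact hz))

/-- Oscillation witnesses of the indexed potential: the fibre sums of the terms' witnesses. -/
theorem isOscBound_indexedPotential {o : ι → ZdEdge d → ℝ} (ho : ∀ i, Dobrushin.IsOscBound (φ i) (o i))
    (X : Finset (ZdEdge d)) :
    Dobrushin.IsOscBound (indexedPotential fib φ X) fun y => ∑ i ∈ fib X, o i y := by
  refine ⟨fun y => Finset.sum_nonneg fun i _ => (ho i).nonneg y, fun y U V hUV => ?_⟩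
  simp only [indexedPotential_apply]
  rw [← Finset.sum_sub_distrib]
  exact (Finset.abs_sum_le_sum_abs _ _).trans (Finset.sum_le_sum fun i _ => (ho i).le y U V hUV)

/-- Lipschitz witnesses of the indexed potential: the fibre sums of the terms' witnesses. -/
theorem isLipBound_indexedPotential {l : ι → ZdEdge d → ℝ} (hl : ∀ i, IsLipBound suFrobDist (φ i) (l i))
    (X : Finset (ZdEdge d)) :
    IsLipBound suFrobDist (indexedPotential fib φ X) fun y => ∑ i ∈ fib X, l i y := by
  refine ⟨fun y => Finset.sum_nonneg fun i _ => (hl i).nonneg y, fun y U V hUV => ?_⟩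
  simp only [indexedPotential_apply]
  rw [← Finset.sum_sub_distrib, Finset.sum_mul]
  exact (Finset.abs_sum_le_sum_abs _ _).trans (Finset.sum_le_sum fun i _ => (hl i).le y U V hUV)

/-- A summable link majorant of the indexed potential: the fibre sums of termwise bounds summable
through every link. -/
theorem isLinkSummable_indexedPotential (hfib : ∀ X i, i ∈ fib X ↔ code i = X) {M : ι → ℝ}
    (hM : ∀ i U, |φ i U| ≤ M i) (hMs : ∀ e, Summable fun i => if e ∈ code i then M i else 0) :
    IsLinkSummable (indexedPotential fib φ) fun X => ∑ i ∈ fib X, M i := by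
  have hM0 : ∀ i, 0 ≤ M i := fun i => (abs_nonneg _).trans (hM i (Classical.arbitrary _))
  refine ⟨fun X U => ?_, fun e => ?_⟩
  · simp only [indexedPotential_apply]
    exact (Finset.abs_sum_le_sum_abs _ _).trans (Finset.sum_le_sum fun i _ => hM i U)
  · have hg0 : ∀ i, 0 ≤ (if e ∈ code i then M i else 0) := fun i => by
      split_ifs
      · exact hM0 i
      · exact le_rfl
    have h := summable_sum_fib hfib hg0 (hMs e)
    refine h.congr fun X => ?_
    rw [sum_fib_ite_mem_eq hfib]

/-- The pair family `𝟙[e, y ∈ code i] l_i(y)` is summable in `i`: for `y = e` by the self-modulus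
hypothesis, for `y ≠ e` because it is dominated by the weighted row divided by the weight of `y`. -/
theorem summable_pair_of_row {l : ι → ZdEdge d → ℝ} (hl0 : ∀ i y, 0 ≤ l i y) {t : ℝ} (e y : ZdEdge d)
    (hlself : Summable fun i => if e ∈ code i then l i e else 0)
    (hls : Summable fun i =>
      if e ∈ code i then ∑ y ∈ (code i).erase e, l i y * exp (t * ‖e.1 - y.1‖) else 0) :
    Summable fun i => if e ∈ code i ∧ y ∈ code i then l i y else 0 := by
  classical
  have hpair0 : ∀ i, 0 ≤ (if e ∈ code i ∧ y ∈ code i then l i y else 0) := fun i => by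
    split_ifs
    · exact hl0 i y
    · exact le_rfl
  have hrow0 : ∀ i, 0 ≤ ∑ y ∈ (code i).erase e, l i y * exp (t * ‖e.1 - y.1‖) := fun i =>
    Finset.sum_nonneg fun y _ => mul_nonneg (hl0 i y) (exp_pos _).le
  by_cases hye : y = e
  · subst hye
    refine hlself.congr fun i => ?_
    by_cases h : y ∈ code i
    · simp [h]
    · simp [h]
  · have hw : 0 < exp (t * ‖e.1 - y.1‖) := exp_pos _
    refine Summable.of_nonneg_of_le hpair0 (fun i => ?_) (hls.mul_right (exp (t * ‖e.1 - y.1‖))⁻¹)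
    by_cases hey : e ∈ code i ∧ y ∈ code i
    · rw [if_pos hey, if_pos hey.1]
      have hyX : y ∈ (code i).erase e := Finset.mem_erase.2 ⟨hye, hey.2⟩
      have hnn : ∀ y' ∈ (code i).erase e, 0 ≤ l i y' * exp (t * ‖e.1 - y'.1‖) :=
        fun y' _ => mul_nonneg (hl0 i y') (exp_pos _).le
      have hsingle : l i y * exp (t * ‖e.1 - y.1‖) ≤
          ∑ y' ∈ (code i).erase e, l i y' * exp (t * ‖e.1 - y'.1‖) := Finset.single_le_sum hnn hyX
      calc l i y = l i y * exp (t * ‖e.1 - y.1‖) * (exp (t * ‖e.1 - y.1‖))⁻¹ := by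
            rw [mul_assoc, mul_inv_cancel₀ hw.ne', mul_one]
        _ ≤ (∑ y' ∈ (code i).erase e, l i y' * exp (t * ‖e.1 - y'.1‖)) * (exp (t * ‖e.1 - y.1‖))⁻¹ :=
            mul_le_mul_of_nonneg_right hsingle (inv_nonneg.2 hw.le)
    · rw [if_neg hey]
      split_ifs
      · exact mul_nonneg (hrow0 i) (inv_nonneg.2 hw.le)
      · exact (zero_mul _).ge

/-- **Partial sums of the weighted cross load are bounded by the weighted index row**:
`∑_{y ∈ S, y ≠ e} e^{t‖e-y‖} ∑_{i ∋ e, y} l_i(y) ≤ ∑_{i ∋ e} ∑_{y ∈ code i ∖ e} l_i(y) e^{t‖e-y‖}`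
(exchange of a finite sum with the index series, then enlarge `S ∩ (code i ∖ e)` to `code i ∖ e`). -/
theorem sum_weighted_pair_le_row {l : ι → ZdEdge d → ℝ} (hl0 : ∀ i y, 0 ≤ l i y) {t : ℝ} (e : ZdEdge d)
    (hlself : Summable fun i => if e ∈ code i then l i e else 0)
    (hls : Summable fun i =>
      if e ∈ code i then ∑ y ∈ (code i).erase e, l i y * exp (t * ‖e.1 - y.1‖) else 0)
    (S : Finset (ZdEdge d)) :
    ∑ y ∈ S, (if y = e then 0 else ∑' i, (if e ∈ code i ∧ y ∈ code i then l i y else 0)) *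
        exp (t * ‖e.1 - y.1‖) ≤
      ∑' i, (if e ∈ code i then ∑ y ∈ (code i).erase e, l i y * exp (t * ‖e.1 - y.1‖) else 0) := by
  classical
  -- the summand at `y` as an index series
  set F : ZdEdge d → ι → ℝ := fun y i =>
    if y ∈ (code i).erase e then (if e ∈ code i then l i y * exp (t * ‖e.1 - y.1‖) else 0) else 0 with hF
  have hF0 : ∀ y i, 0 ≤ F y i := fun y i => by
    simp only [hF]
    split_ifs
    · exact mul_nonneg (hl0 i y) (exp_pos _).le
    · exact le_rfl
    · exact le_rfl
  have hFeq : ∀ y i, F y i =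
      (if y = e then 0 else (if e ∈ code i ∧ y ∈ code i then l i y else 0)) * exp (t * ‖e.1 - y.1‖) := by
    intro y i
    simp only [hF, Finset.mem_erase]
    by_cases hye : y = e
    · simp [hye]
    · by_cases he : e ∈ code i
      · by_cases hy : y ∈ code i
        · simp [hye, he, hy]
        · simp [hye, he, hy]
      · simp [hye, he]
  have hFs : ∀ y, Summable (F y) := fun y => by
    have h := (summable_pair_of_row hl0 e y hlself hls).mul_right (exp (t * ‖e.1 - y.1‖))
    refine (h.mul_left (if y = e then 0 else 1)).congr fun i => ?_
    rw [hFeq]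
    split_ifs <;> ring
  have hsummand : ∀ y, (if y = e then 0 else ∑' i, (if e ∈ code i ∧ y ∈ code i then l i y else 0)) *
      exp (t * ‖e.1 - y.1‖) = ∑' i, F y i := by
    intro y
    by_cases hye : y = e
    · simp [hF, hye]
    · rw [if_neg hye, ← tsum_mul_right]
      exact tsum_congr fun i => by rw [hFeq, if_neg hye]
  rw [Finset.sum_congr rfl fun y _ => hsummand y, ← Summable.tsum_finsetSum fun y _ => hFs y]
  refine Summable.tsum_le_tsum (fun i => ?_) (summable_sum fun y _ => hFs y) hls
  by_cases he : e ∈ code i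
  · rw [if_pos he]
    have hFi : ∀ y, F y i = if y ∈ (code i).erase e then l i y * exp (t * ‖e.1 - y.1‖) else 0 := fun y => by
      simp only [hF, if_pos he]
    simp only [hFi]
    rw [← Finset.sum_filter]
    exact Finset.sum_le_sum_of_subset_of_nonneg (fun y hy => (Finset.mem_filter.1 hy).2)
      fun y _ _ => mul_nonneg (hl0 i y) (exp_pos _).le
  · rw [if_neg he]
    refine (Finset.sum_eq_zero fun y _ => ?_).le
    simp only [hF, if_neg he]
    split_ifs <;> rfl

/-- **Indexed families with summable index loads are members of the tier-2 ball.** If every term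
`φ_i` is continuous, depends on its carrier `code i`, is bounded by `M_i`, has oscillation witnesses
`o_i` and Frobenius–Lipschitz witnesses `l_i`, and through every link `e` the index sums converge with
oscillation load `∑_{i ∋ e} o_i(e) ≤ a` and diagonal-free weighted cross load
`∑_{i ∋ e} ∑_{y ∈ code i ∖ e} l_i(y) e^{t‖e - y‖_∞} ≤ Λ` (and the bounds `M_i`, the self-moduli `l_i(e)`
are summable through `e`), then `W = indexedPotential fib φ` lies in `MemBallZdS a Λ t`. -/
theorem memBallZdS_indexed (hfib : ∀ X i, i ∈ fib X ↔ code i = X)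
    (hcont : ∀ i, Continuous (φ i)) (hdep : ∀ i, DependsOn (φ i) (↑(code i) : Set (ZdEdge d)))
    {M : ι → ℝ} (hM : ∀ i U, |φ i U| ≤ M i) (hMs : ∀ e, Summable fun i => if e ∈ code i then M i else 0)
    {o l : ι → ZdEdge d → ℝ} (ho : ∀ i, Dobrushin.IsOscBound (φ i) (o i))
    (hl : ∀ i, IsLipBound suFrobDist (φ i) (l i)) {a Λ t : ℝ}
    (hos : ∀ e, Summable fun i => if e ∈ code i then o i e else 0)
    (hoa : ∀ e, ∑' i, (if e ∈ code i then o i e else 0) ≤ a)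
    (hlself : ∀ e, Summable fun i => if e ∈ code i then l i e else 0)
    (hls : ∀ e, Summable fun i =>
      if e ∈ code i then ∑ y ∈ (code i).erase e, l i y * exp (t * ‖e.1 - y.1‖) else 0)
    (hlΛ : ∀ e, ∑' i, (if e ∈ code i then ∑ y ∈ (code i).erase e, l i y * exp (t * ‖e.1 - y.1‖) else 0) ≤ Λ) :
    MemBallZdS a Λ t (indexedPotential fib φ) := by
  classical
  have ho0 : ∀ i y, 0 ≤ o i y := fun i y => (ho i).nonneg y
  have hl0 : ∀ i y, 0 ≤ l i y := fun i y => (hl i).nonneg y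
  have hgo0 : ∀ e i, 0 ≤ (if e ∈ code i then o i e else 0) := fun e i => by
    split_ifs
    · exact ho0 i e
    · exact le_rfl
  have hpair0 : ∀ e y i, 0 ≤ (if e ∈ code i ∧ y ∈ code i then l i y else 0) := fun e y i => by
    split_ifs
    · exact hl0 i y
    · exact le_rfl
  have hpair : ∀ e y, Summable fun i => if e ∈ code i ∧ y ∈ code i then l i y else 0 := fun e y =>
    summable_pair_of_row hl0 e y (hlself e) (hls e)
  -- the cross coefficient
  set ℓ : ZdEdge d → ZdEdge d → ℝ := fun e y => ∑' i, (if e ∈ code i ∧ y ∈ code i then l i y else 0) with hℓ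
  have hℓ0 : ∀ e y, 0 ≤ ℓ e y := fun e y => tsum_nonneg (hpair0 e y)
  have hf0 : ∀ e y, 0 ≤ (if y = e then 0 else ℓ e y) * exp (t * ‖e.1 - y.1‖) := fun e y =>
    mul_nonneg (by split_ifs <;> first | exact le_rfl | exact hℓ0 e y) (exp_pos _).le
  refine ⟨fun X => ?_, dependsOn_indexedPotential hfib hdep, ⟨_, isLinkSummable_indexedPotential hfib hM hMs⟩,
    fun X y => ∑ i ∈ fib X, o i y, fun X y => ∑ i ∈ fib X, l i y, ℓ,
    fun X => isOscBound_indexedPotential ho X, fun X => isLipBound_indexedPotential hl X,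
    fun e => ?_, fun e => ?_, fun e y => ?_, fun e y _ => ?_, fun e => ?_, fun e => ?_⟩
  · -- continuity
    change Continuous fun U => ∑ i ∈ fib X, φ i U
    exact continuous_finsetSum _ fun i _ => hcont i
  · -- summable oscillation load
    refine (summable_sum_fib hfib (hgo0 e) (hos e)).congr fun X => ?_
    rw [sum_fib_ite_mem_eq hfib]
  · -- oscillation load `≤ a`
    have heq : (fun X => if e ∈ X then ∑ i ∈ fib X, o i e else 0) =
        fun X => ∑ i ∈ fib X, (if e ∈ code i then o i e else 0) :=
      funext fun X => (sum_fib_ite_mem_eq hfib X e _).symm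
    rw [heq]
    exact (tsum_sum_fib_le hfib (hgo0 e) (hos e)).trans (hoa e)
  · -- summable Lipschitz moduli through `e, y`
    refine (summable_sum_fib hfib (hpair0 e y) (hpair e y)).congr fun X => ?_
    rw [sum_fib_ite_mem_mem_eq hfib]
  · -- the cross coefficient dominates
    have heq : (fun X => if e ∈ X ∧ y ∈ X then ∑ i ∈ fib X, l i y else 0) =
        fun X => ∑ i ∈ fib X, (if e ∈ code i ∧ y ∈ code i then l i y else 0) :=
      funext fun X => (sum_fib_ite_mem_mem_eq hfib X e y _).symm
    rw [heq]
    exact tsum_sum_fib_le hfib (hpair0 e y) (hpair e y)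
  · -- summable weighted cross load: bounded partial sums
    exact summable_of_sum_le (hf0 e) fun S =>
      (sum_weighted_pair_le_row hl0 e (hlself e) (hls e) S).trans (hlΛ e)
  · -- weighted cross load `≤ Λ`
    exact Real.tsum_le_of_sum_le (hf0 e) fun S =>
      (sum_weighted_pair_le_row hl0 e (hlself e) (hls e) S).trans (hlΛ e)

end Member

end Summit.Ventures.YMGap.RobustBall
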